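import Mathlib
import Summits.Ventures.PercRepro2.Defs
import Summits.Ventures.PercRepro2.Independence
import Summits.Ventures.PercRepro2.Harris
import Summits.Ventures.PercRepro2.Graph
import Summits.Ventures.PercRepro2.Exploration
import Summits.Ventures.PercRepro2.Events
import Summits.Ventures.PercRepro2.Induced
import Summits.Ventures.PercRepro2.R4Defs
import Summits.Ventures.PercRepro2.R4Ladder
import Summits.Ventures.PercRepro2.R2PrimeThreeReduction

/-!
# The surviving rungs above R4+ (blind cell PercRepro2, typer-1; statements only)

`proofs/LEAD-PROOFSHAPES.md` §8.11 and its ADDENDUM (the margin algebra at `|A| = 2`, `U = C(a₂)`,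
`a₁ = a*` the minimiser), and §8.9 ADDENDUM 6 (SC′ at `|A| = 3`).

Margins (conditional probabilities as ratios, `x / 0 = 0`):
`λ₃ = P(b ∈ U, a₁ ∉ U)`, `λ₄ = P(a₁ ↔ b, a₁ ∉ U)`,
`v₁ = P(o ∈ U | b ∈ U, a₁ ∉ U) − P(o ∈ U | a₁ ∉ U) ≥ 0` (vdB–Kahn),
`v₂ = P(o ∈ U | a₁ ∉ U) − P(o ∈ U | a₁, b ∉ U) ≥ 0` (vdB–Kahn),
`T1 = λ₄ · (P(o ∈ U | a₁, b ∉ U) − P(o ∈ U | a₁ ↔ b, a₁ ∉ U)) ≥ 0` (BHK thinning).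
Every rung reads `T1 + (weights on v₁, v₂) ≥ LOSS(a₁)` under the conn-order `P(a₁ ↔ b) ≤ P(a₂ ↔ b)`:

* **(H3)** `T1 + λ₃ (v₁ + v₂) ≥ LOSS` ⟸ **(H3′)** `T1 + λ₃ v₁ + λ₄ v₂ ≥ LOSS` ⟸ **(H4)**
  `T1 + λ₄ (v₁ + v₂) ≥ LOSS` — all three 0 violations / 6,776,852 at `n = 7` (engine D17, both
  tails + extreme per-edge vectors + near-ties; equalities 794,189 / 794,189 / 1,036,177);
  (H4) ⇒ R4+ at `|A| = 2` since `λ₄ ≤ λ₃`;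
* **(f)** `T1 + λ₄ v₁ ≥ LOSS` and **(k)** `T1 + λ₃ v₁ ≥ LOSS` are FALSE (NEG-12, `c7_00384`,
  typed for the negative record);
* **SC′** (`|A| = 3`, `Ũ = C(a₂) ∪ C(a₃)`, `x | y` = `x, y ∈ Ũ` in different `G`-clusters):
  `P(o ∈ Ũ | a₁ ∉ Ũ) · [P(b ∈ Ũ) − P(a₁ ↔ b) − P(a₁ | b)] ≥ P(o | b) − P(a₁ | b, o ∈ Ũ)`,
  written EXACTLY as the hypothesis `hSC` of mine-2's reduction theorem
  `UnionCluster.r2prime3_of_quant_of_SC` (events `UnionCluster.inU`, `UnionCluster.split`);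
  0 / 9,209,811 at `n = 7`, `|A| = 3` and 0 / 4,701,526 at `|A| = 4` (engine D19, 29 weight
  classes incl. both tails, extreme vectors, near-ties; equalities = R2′'s). The cell's crux for
  KN (3) at `|A| ≥ 3`: R2′(3) ⟸ SC′ + quantitative R10 at the seed set (p1) + G′-ORDER
  (`gprime_order`).
-/

namespace Summit.Ventures.PercRepro2

section Margins

variable {V : Type*} {E : Type*} [Fintype E] [DecidableEq E] [Fintype V] [DecidableEq V]
  {R : Type*} [Field R] [LinearOrder R]

/-- `λ₃ = P(b ∈ U, a₁ ∉ U)`, `U = C(a₂)`. -/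
noncomputable def lam3 (p : E → R) (ends : E → Sym2 V) (a₁ a₂ b : V) : R :=
  prob p (connEvent ends a₂ b ∩ (connEvent ends a₂ a₁)ᶜ)

/-- `λ₄ = P(a₁ ↔ b, a₁ ∉ U)`, `U = C(a₂)`. -/
noncomputable def lam4 (p : E → R) (ends : E → Sym2 V) (a₁ a₂ b : V) : R :=
  prob p (connEvent ends a₁ b ∩ (connEvent ends a₂ a₁)ᶜ)

/-- `P(o ∈ U | b ∈ U, a₁ ∉ U)`. -/
noncomputable def condOGivenB (p : E → R) (ends : E → Sym2 V) (o a₁ a₂ b : V) : R :=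
  prob p (connEvent ends o a₂ ∩ connEvent ends a₂ b ∩ (connEvent ends a₂ a₁)ᶜ) /
    lam3 p ends a₁ a₂ b

/-- `P(o ∈ U | a₁ ∉ U)`. -/
noncomputable def condO (p : E → R) (ends : E → Sym2 V) (o a₁ a₂ : V) : R :=
  prob p (connEvent ends o a₂ ∩ (connEvent ends a₂ a₁)ᶜ) / prob p (connEvent ends a₂ a₁)ᶜ

/-- `P(o ∈ U | a₁, b ∉ U)`. -/
noncomputable def condOGivenAvoid (p : E → R) (ends : E → Sym2 V) (o a₁ a₂ b : V) : R :=
  prob p (connEvent ends o a₂ ∩ avoidAll ends a₂ {a₁, b}) / prob p (avoidAll ends a₂ {a₁, b})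

/-- `P(o ∈ U | a₁ ↔ b, a₁ ∉ U)`. -/
noncomputable def condOGivenConn (p : E → R) (ends : E → Sym2 V) (o a₁ a₂ b : V) : R :=
  prob p (connEvent ends o a₂ ∩ connEvent ends a₁ b ∩ (connEvent ends a₂ a₁)ᶜ) /
    lam4 p ends a₁ a₂ b

/-- The first vdB–Kahn margin `v₁ = P(o ∈ U | b ∈ U, a₁ ∉ U) − P(o ∈ U | a₁ ∉ U)`. -/
noncomputable def marginV1 (p : E → R) (ends : E → Sym2 V) (o a₁ a₂ b : V) : R :=
  condOGivenB p ends o a₁ a₂ b - condO p ends o a₁ a₂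

/-- The second vdB–Kahn margin `v₂ = P(o ∈ U | a₁ ∉ U) − P(o ∈ U | a₁, b ∉ U)`. -/
noncomputable def marginV2 (p : E → R) (ends : E → Sym2 V) (o a₁ a₂ b : V) : R :=
  condO p ends o a₁ a₂ - condOGivenAvoid p ends o a₁ a₂ b

/-- The BHK margin `T1 = λ₄ · (P(o ∈ U | a₁, b ∉ U) − P(o ∈ U | a₁ ↔ b, a₁ ∉ U))`. -/
noncomputable def marginT1 (p : E → R) (ends : E → Sym2 V) (o a₁ a₂ b : V) : R :=
  lam4 p ends a₁ a₂ b * (condOGivenAvoid p ends o a₁ a₂ b - condOGivenConn p ends o a₁ a₂ b)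

/-- **(H3)**: `T1 + λ₃ (v₁ + v₂) ≥ LOSS(a₁)` under the conn-order (0 / 6,776,852 at `n = 7`). -/
def H3 (p : E → R) (ends : E → Sym2 V) (o a₁ a₂ b : V) : Prop :=
  ConnOrder p ends a₁ a₂ b →
    lossTerm p ends o a₁ a₂ b ≤ marginT1 p ends o a₁ a₂ b +
      lam3 p ends a₁ a₂ b * (marginV1 p ends o a₁ a₂ b + marginV2 p ends o a₁ a₂ b)

/-- **(H3′)**: `T1 + λ₃ v₁ + λ₄ v₂ ≥ LOSS(a₁)` under the conn-order (0 / 6,776,852 at `n = 7`). -/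
def H3Prime (p : E → R) (ends : E → Sym2 V) (o a₁ a₂ b : V) : Prop :=
  ConnOrder p ends a₁ a₂ b →
    lossTerm p ends o a₁ a₂ b ≤ marginT1 p ends o a₁ a₂ b +
      lam3 p ends a₁ a₂ b * marginV1 p ends o a₁ a₂ b +
      lam4 p ends a₁ a₂ b * marginV2 p ends o a₁ a₂ b

/-- **(H4)**: `T1 + λ₄ (v₁ + v₂) ≥ LOSS(a₁)` under the conn-order (0 / 6,776,852 at `n = 7`,
1,036,177 equalities) — p1's proof target, the cheapest surviving strengthening of R4+. -/
def H4 (p : E → R) (ends : E → Sym2 V) (o a₁ a₂ b : V) : Prop :=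
  ConnOrder p ends a₁ a₂ b →
    lossTerm p ends o a₁ a₂ b ≤ marginT1 p ends o a₁ a₂ b +
      lam4 p ends a₁ a₂ b * (marginV1 p ends o a₁ a₂ b + marginV2 p ends o a₁ a₂ b)

/-- **(f)** `T1 + λ₄ v₁ ≥ LOSS(a₁)` — FALSE in general (NEG-12: `c7_00384`, extreme vector
`wext4`, `(o, b) = (3, 1)`, slack `≈ −1.67·10⁻⁵`); typed for the negative record. -/
def RungF (p : E → R) (ends : E → Sym2 V) (o a₁ a₂ b : V) : Prop :=
  ConnOrder p ends a₁ a₂ b →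
    lossTerm p ends o a₁ a₂ b ≤ marginT1 p ends o a₁ a₂ b +
      lam4 p ends a₁ a₂ b * marginV1 p ends o a₁ a₂ b

/-- **(k)** `T1 + λ₃ v₁ ≥ LOSS(a₁)` — FALSE in general (NEG-12, same witness, slack
`≈ −1.33·10⁻⁸`); typed for the negative record. -/
def RungK (p : E → R) (ends : E → Sym2 V) (o a₁ a₂ b : V) : Prop :=
  ConnOrder p ends a₁ a₂ b →
    lossTerm p ends o a₁ a₂ b ≤ marginT1 p ends o a₁ a₂ b +
      lam3 p ends a₁ a₂ b * marginV1 p ends o a₁ a₂ b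

end Margins

section SCPrime

open UnionCluster

variable {V : Type*} {E : Type*} [Fintype E] [DecidableEq E]
  {R : Type*} [Field R] [LinearOrder R]

/-- **SC′, the bare inequality** — verbatim the hypothesis `hSC` of
`UnionCluster.r2prime3_of_quant_of_SC`: with `Ũ = C(a₂) ∪ C(a₃)` (`inU`), `x | y` (`split`),
`c′ = P(o ∈ Ũ | a₁ ∉ Ũ)`, `gap′ = P(b ∈ Ũ) − P(a₁ ↔ b) − P(a₁ | b)`, `corr = P(o | b) − P(a₁ | b, o ∈ Ũ)`:
`c′ · gap′ ≥ corr`. -/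
def SCPrimeIneq (p : E → R) (ends : E → Sym2 V) (o a₁ a₂ a₃ b : V) : Prop :=
  prob p (inU ends a₂ a₃ o ∩ (inU ends a₂ a₃ a₁)ᶜ) / prob p (inU ends a₂ a₃ a₁)ᶜ *
      (prob p (inU ends a₂ a₃ b) - prob p (connEvent ends a₁ b) - prob p (split ends a₂ a₃ a₁ b)) ≥
    prob p (split ends a₂ a₃ o b) - prob p (split ends a₂ a₃ a₁ b ∩ inU ends a₂ a₃ o)

/-- **SC′** (§8.9 ADDENDUM 6; `|A| = 3`, `a₁ = a*` the minimiser): `SCPrimeIneq` under the two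
order hypotheses `P(a₁ ↔ b) ≤ P(a₂ ↔ b)`, `P(a₁ ↔ b) ≤ P(a₃ ↔ b)`. Status: OPEN (0 violations at
`n ≤ 7`, engine D19). -/
def SCPrime (p : E → R) (ends : E → Sym2 V) (o a₁ a₂ a₃ b : V) : Prop :=
  prob p (connEvent ends a₁ b) ≤ prob p (connEvent ends a₂ b) →
  prob p (connEvent ends a₁ b) ≤ prob p (connEvent ends a₃ b) →
    SCPrimeIneq p ends o a₁ a₂ a₃ b

end SCPrime

section Closures

variable (R : Type) [Field R] [LinearOrder R] [IsStrictOrderedRing R]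

/-- (H4) for every finite graph and every minimiser `a₁` (`o ∉ {a₁, a₂, b}`, `a₁ ≠ a₂`). -/
def H4_all : Prop :=
  ∀ (V E : Type) [Fintype V] [DecidableEq V] [Fintype E] [DecidableEq E]
    (ends : E → Sym2 V) (p : E → R), IsProbVec p →
    ∀ o a₁ a₂ b : V, a₁ ≠ a₂ → o ≠ a₁ → o ≠ a₂ → o ≠ b → H4 p ends o a₁ a₂ b

/-- (H3′) for every finite graph and every minimiser `a₁`. -/
def H3Prime_all : Prop :=
  ∀ (V E : Type) [Fintype V] [DecidableEq V] [Fintype E] [DecidableEq E]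
    (ends : E → Sym2 V) (p : E → R), IsProbVec p →
    ∀ o a₁ a₂ b : V, a₁ ≠ a₂ → o ≠ a₁ → o ≠ a₂ → o ≠ b → H3Prime p ends o a₁ a₂ b

/-- (H3) for every finite graph and every minimiser `a₁`. -/
def H3_all : Prop :=
  ∀ (V E : Type) [Fintype V] [DecidableEq V] [Fintype E] [DecidableEq E]
    (ends : E → Sym2 V) (p : E → R), IsProbVec p →
    ∀ o a₁ a₂ b : V, a₁ ≠ a₂ → o ≠ a₁ → o ≠ a₂ → o ≠ b → H3 p ends o a₁ a₂ b

/-- SC′ for every finite graph, `A = {a₁, a₂, a₃}` distinct, `a₁` the minimiser, `o, b ∉ A`,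
`o ≠ b`. -/
def SCPrime_all : Prop :=
  ∀ (V E : Type) [Fintype V] [DecidableEq V] [Fintype E] [DecidableEq E]
    (ends : E → Sym2 V) (p : E → R), IsProbVec p →
    ∀ o a₁ a₂ a₃ b : V, a₁ ≠ a₂ → a₁ ≠ a₃ → a₂ ≠ a₃ → o ≠ a₁ → o ≠ a₂ → o ≠ a₃ → o ≠ b →
      b ≠ a₁ → b ≠ a₂ → b ≠ a₃ → SCPrime p ends o a₁ a₂ a₃ b

end Closures

end Summit.Ventures.PercRepro2
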